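import Mathlib.Algebra.Order.Chebyshev
import Mathlib.Algebra.Ring.GeomSum
import Mathlib.Algebra.BigOperators.Intervals
import Mathlib.RingTheory.Polynomial.Chebyshev
import Literature.NumberTheory.EllipticCurves.MurtySinhaMultiplicity
import HarnessLib

/-!
# Murty–Sinha's multiplicity bound: the combinatorial core (Theorem 22 from Chebyshev moments)

Sibling file of `Literature.NumberTheory.EllipticCurves.MurtySinhaMultiplicity`, which vendors
M. R. Murty, K. Sinha, *Effective equidistribution of eigenvalues of Hecke operators*, J. Number
Theory **129** (2009) 681–714 [MurtySinha2009], eq. (1) p. 683 (= Cor. 23 p. 702) in weight `2` as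
the named fact `murtySinha2009_eigenvalue_multiplicity_weightTwo`.

## The printed proof (loc. cit. §§2–11) and what this file proves

Murty–Sinha deduce eq. (1) from two inputs:

1. (§§7–9, Thm. 10 = the Eichler–Selberg trace formula, Lemma 17, Thm. 18) for `p ∤ N` the
   normalised eigenvalues `x_i = a_{p,i}/p^{(k-1)/2}`, `1 ≤ i ≤ r = s(N,k)`, of `T'_p = T_p/p^{(k-1)/2}`
   have Chebyshev moments `Σ_i X_m(x_i) = Tr T'_{p^m} = r·c'_m + O(p^{3m/2} 2^{ν(N)} log p^m + √N d(N))`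
   with `c'_m = p^{-m/2}` for `m` even and `0` for `m` odd (`X_m` the Chebyshev polynomials of the
   second kind on `[-2, 2]`, `X_m(2 cos θ) = sin (m+1)θ / sin θ`, so that `T'_{p^m} = X_m(T'_p)`);
2. (§§2–4, 10–11, Thm. 8 and Thm. 22) an "all-purpose" Erdős–Turán inequality built from the
   Beurling–Selberg trigonometric polynomials, whose degenerate-interval case is **Thm. 22**
   (p. 702): `#{i ≤ r : θ_i = α} ≤ r/(M+1) + (error of the moments of order ≤ M)` for every `M ≥ 1`;
   Cor. 23 then takes `M = c log kN / log p`.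

Input 1 is the named fact `Literature.NumberTheory.Automorphic.HeckeTraceFormulaGL2Level`
(Cohen–Oesterlé form of the Eichler–Selberg trace formula), not yet discharged in the tree, so the
fact `murtySinha2009_eigenvalue_multiplicity_weightTwo` is **not** discharged here.

This file PROVES input 2 in a self-contained algebraic form,
`MurtySinha.card_filter_eq_le_of_chebMoments`: for reals `x_i` (`i ∈ ι`, `r = |ι|`), `|α| ≤ 2`,
`0 ≤ q < 1`, numbers `γ_c` with `|γ_c| ≤ q^c`, and `E` with `|Σ_i X_c(x_i) - r γ_c| ≤ E` for all
`c ≤ 2M`,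

  `#{i : x_i = α} ≤ 8 r / ((1-q)(1-q²)(M+1)) + 4 (M+1) E`,

which is Thm. 22 with the absolute constant `1` of `r/(M+1)` replaced by `8/((1-q)(1-q²))`
(`≤ 55` for `q = p^{-1/2} ≤ 2^{-1/2}`; the constant in eq. (1)/Cor. 23 is unspecified).

**Deviation from print (method, not statement).** Mathlib has no Beurling–Selberg/Vaaler
polynomials (loc. cit. §3), so instead of the Selberg minorant/majorant of `χ_{[α,α]}` we use the
Christoffel–Darboux (polynomial) test function of the equidistribution literature: with
`w_a = X_a(α)`, `K = Σ_{a ≤ M} w_a²` and `P(y) = Σ_{a ≤ M} w_a X_a(y)` one has `P(α) = K` and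
`P² ≥ 0`, so `#{i : x_i = α} · K² ≤ Σ_i P(x_i)²`; expanding `P²` by the linearisation formula
`X_a X_b = Σ_{j ≤ min(a,b)} X_{a+b-2j}` (`MurtySinha.chebX_mul_chebX`, the Clebsch–Gordan rule for
`SU(2)`, equivalent to Lemma 17's `2 cos mθ = X_m - X_{m-2}`) turns `Σ_i P(x_i)²` into a combination
of the moments `Σ_i X_c(x_i)`, `c ≤ 2M`; the main term is bounded by the row-sum (Schur) estimate
`Σ_b q^{|a-b|} ≤ 2/(1-q)` and AM–GM, the error term by Cauchy–Schwarz, and `K ≥ (M+1)/4` on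
`[-2, 2]` follows from the invariant `X_{n+1}² - α X_{n+1} X_n + X_n² = 1`
(`MurtySinha.chebX_sq_invariant`, Cassini's identity for `U_n`). Everything is finite algebra over
`ℝ`; no measure `μ_p`, Fourier series or trigonometry is needed, and the hypothesis `|γ_c| ≤ q^c`
is exactly what Thm. 18 (`c_0 = 1`, `c'_m = p^{-m/2}·[m even]`) supplies with `q = p^{-1/2}`.

## What is deliberately NOT here

The discharge `murtySinha2009_eigenvalue_multiplicity_weightTwo_holds`. Given
`HeckeTraceFormulaGL2Level N 1 2` it remains to (B) pass from `heckeT (Gamma0 N) 2 p`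
(self-adjoint: `heckeT_selfAdjoint_holds`; finite-dimensional: `finiteDimensional_cuspForm_gamma0`;
no Jordan blocks: `maxGenEigenspace_eq_eigenspace_of_selfAdjoint`) to a real eigen-multiset
`x_i`, (C) identify `cuspidalHeckeTrace N 2 1 (p^m)` with `p^{m/2} Σ_i X_m(x_i/√p)` through
`liftToGamma1` (`heckeT_liftToGamma1`, `liftToGamma1_injective`), (E) bound the geometric side
(`ellipticTerm`, `hyperbolicTerm`, `parabolicTerm`; `n = 1` gives `r = ψ(N)/12 + O(√N d(N))`), and
(F) choose `M ≍ log 2N / log p`; see the unit NOTES of the literature-prover seat.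

## References

* [MurtySinha2009] M. R. Murty, K. Sinha, J. Number Theory 129 (2009) 681–714: Thm. 8 (p. 686),
  Lemma 17 and Thm. 18 (pp. 697–698), Thm. 22 and Cor. 23 (p. 702), eq. (1) (p. 683). Held:
  `paper:doi-10-1016-j-jnt-2008-10-010` (PDF page = journal page − 680 + 1).
* J.-P. Serre, *Répartition asymptotique des valeurs propres de l'opérateur de Hecke `T_p`*,
  J. Amer. Math. Soc. 10 (1997) 75–102, §2 (the polynomials `X_n`).
-/

noncomputable section

namespace Literature.NumberTheory.EllipticCurves.ModularForms

namespace MurtySinha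

open Finset

/-! ### Chebyshev polynomials of the second kind on `[-2, 2]` -/

/-- The Chebyshev polynomials of the second kind transported to `[-2, 2]`, as real functions:
`X_n(x) = U_n(x/2)` with Mathlib's `Polynomial.Chebyshev.U` (a specialisation, not a new notion),
so that `X_0 = 1`, `X_1(x) = x`, `X_{n+2}(x) = x X_{n+1}(x) - X_n(x)` and
`X_n(2 cos θ) = sin((n+1)θ)/sin θ` (Murty–Sinha §8, p. 697: "the `n`th Chebychev polynomial
`X_n(x) = sin (n+1)θ / sin θ`, `x = 2 cos θ`"; Serre 1997, §2). They satisfy `T'_{p^n} = X_n(T'_p)`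
for the normalised Hecke operators (loc. cit. Lemma 17).
[cite: MurtySinha2009, §8 p. 697 (definition of X_n) and Lemma 17] -/
def chebX (n : ℕ) (x : ℝ) : ℝ :=
  (Polynomial.Chebyshev.U ℝ n).eval (x / 2)

/-- Unfolding: `X_n(x) = U_n(x/2)`. [cite: MurtySinha2009, §8 p. 697] -/
theorem chebX_eq_eval_U (n : ℕ) (x : ℝ) : chebX n x = (Polynomial.Chebyshev.U ℝ n).eval (x / 2) :=
  rfl

/-- `X_0 = 1`. [cite: MurtySinha2009, §8 p. 697] -/
@[simp] theorem chebX_zero (x : ℝ) : chebX 0 x = 1 := by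
  simp [chebX]

/-- `X_1(x) = x`. [cite: MurtySinha2009, §8 p. 697] -/
@[simp] theorem chebX_one (x : ℝ) : chebX 1 x = x := by
  simp [chebX]
  ring

/-- The three-term recursion `X_{n+2} = x X_{n+1} - X_n` (from `U_{n+2} = 2X U_{n+1} - U_n`).
[cite: MurtySinha2009, §8 p. 697] -/
theorem chebX_add_two (n : ℕ) (x : ℝ) : chebX (n + 2) x = x * chebX (n + 1) x - chebX n x := by
  simp only [chebX]
  push_cast
  rw [Polynomial.Chebyshev.U_add_two]
  simp only [Polynomial.eval_sub, Polynomial.eval_mul, Polynomial.eval_ofNat, Polynomial.eval_X]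
  ring

/-- The product rule `X_{a+1} X_{b+1} = X_{a+b+2} + X_a X_b` (one step of the Clebsch–Gordan /
linearisation formula for `U_n`; for `a = 0` it is the recursion). [folklore] -/
theorem chebX_succ_mul_chebX_succ (x : ℝ) (a b : ℕ) :
    chebX (a + 1) x * chebX (b + 1) x = chebX (a + b + 2) x + chebX a x * chebX b x := by
  -- two-step induction on `a`, uniformly in `b`
  have key : ∀ a : ℕ,
      (∀ b : ℕ, chebX (a + 1) x * chebX (b + 1) x = chebX (a + b + 2) x + chebX a x * chebX b x) ∧
      (∀ b : ℕ, chebX (a + 2) x * chebX (b + 1) x =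
        chebX (a + b + 3) x + chebX (a + 1) x * chebX b x) := by
    intro a
    induction a with
    | zero =>
      refine ⟨fun b ↦ ?_, fun b ↦ ?_⟩
      · have e : chebX (0 + b + 2) x = x * chebX (b + 1) x - chebX b x := by
          rw [show 0 + b + 2 = b + 2 by ring]
          exact chebX_add_two b x
        rw [e, zero_add, chebX_one, chebX_zero]
        ring
      · have e2 : chebX (0 + 2) x = x * x - 1 := by
          rw [show 0 + 2 = 0 + 2 from rfl, chebX_add_two 0 x, chebX_one, chebX_zero]
        have e3 : chebX (0 + b + 3) x = x * chebX (b + 2) x - chebX (b + 1) x := by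
          rw [show 0 + b + 3 = (b + 1) + 2 by ring]
          exact chebX_add_two (b + 1) x
        have e4 : chebX (b + 2) x = x * chebX (b + 1) x - chebX b x := chebX_add_two b x
        rw [e2, e3, e4, zero_add, chebX_one]
        ring
    | succ a ih =>
      obtain ⟨h1, h2⟩ := ih
      refine ⟨fun b ↦ ?_, fun b ↦ ?_⟩
      · have := h2 b
        rw [show a + 1 + 1 = a + 2 by ring, show a + 1 + b + 2 = a + b + 3 by ring]
        exact this
      · -- `X_{a+3} X_{b+1} = (x X_{a+2} - X_{a+1}) X_{b+1}`
        have e1 : chebX (a + 1 + 2) x = x * chebX (a + 2) x - chebX (a + 1) x := by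
          rw [show a + 1 + 2 = (a + 1) + 2 from rfl]
          exact chebX_add_two (a + 1) x
        have e2 : chebX (a + 1 + b + 3) x = x * chebX (a + b + 3) x - chebX (a + b + 2) x := by
          rw [show a + 1 + b + 3 = (a + b + 2) + 2 by ring]
          exact chebX_add_two (a + b + 2) x
        have e3 : chebX (a + 1 + 1) x = chebX (a + 2) x := by
          rw [show a + 1 + 1 = a + 2 by ring]
        have hb2 := h2 b
        have hb1 := h1 b
        rw [e1, e2, e3, sub_mul, mul_assoc, hb2, hb1, chebX_add_two a x]
        ring
  exact (key a).1 b

/-- **Linearisation (Clebsch–Gordan) formula** `X_a X_b = Σ_{j=0}^{min(a,b)} X_{a+b-2j}`: the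
product of two Chebyshev polynomials of the second kind is the sum of those of degrees
`|a-b|, |a-b|+2, …, a+b` (the rule by which Murty–Sinha pass between the power moments
`Tr T'_{p^m} = Σ_i X_m(x_i)` and trigonometric sums, §8 p. 697). [folklore] -/
theorem chebX_mul_chebX (x : ℝ) (a b : ℕ) :
    chebX a x * chebX b x = ∑ j ∈ range (min a b + 1), chebX (a + b - 2 * j) x := by
  -- induction on `min a b`
  suffices h : ∀ n a b : ℕ, min a b = n →
      chebX a x * chebX b x = ∑ j ∈ range (n + 1), chebX (a + b - 2 * j) x from
    h (min a b) a b rfl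
  intro n
  induction n with
  | zero =>
    intro a b hab
    rcases Nat.eq_zero_or_pos a with ha | ha
    · subst ha
      simp
    · have hb : b = 0 := by omega
      subst hb
      simp
  | succ n ih =>
    intro a b hab
    obtain ⟨a', rfl⟩ : ∃ a', a = a' + 1 := ⟨a - 1, by omega⟩
    obtain ⟨b', rfl⟩ : ∃ b', b = b' + 1 := ⟨b - 1, by omega⟩
    have hmin : min a' b' = n := by omega
    rw [chebX_succ_mul_chebX_succ, ih a' b' hmin]
    conv_rhs => rw [Finset.sum_range_succ']
    rw [add_comm (chebX (a' + b' + 2) x)]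
    congr 1
    · refine Finset.sum_congr rfl fun j _ ↦ ?_
      congr 1
      omega
    · congr 1
      omega

/-- **Cassini-type invariant** of the recursion: `X_{n+1}(x)² - x X_{n+1}(x) X_n(x) + X_n(x)² = 1`
for all `n` (the quadratic form `u² - x u v + v²` is preserved by `(u, v) ↦ (x u - v, u)`, which has
determinant `1`). [folklore] -/
theorem chebX_sq_invariant (x : ℝ) (n : ℕ) :
    chebX (n + 1) x ^ 2 - x * chebX (n + 1) x * chebX n x + chebX n x ^ 2 = 1 := by
  induction n with
  | zero =>
    simp only [zero_add, chebX_one, chebX_zero]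
    ring
  | succ n ih =>
    rw [show n + 1 + 1 = n + 2 from rfl, chebX_add_two n x]
    linear_combination ih

/-- On `[-2, 2]` two consecutive values cannot both be small: `X_{n+1}(x)² + X_n(x)² ≥ 1/2` for
`|x| ≤ 2` (from the invariant, since `u² - x u v + v² ≤ 2 (u² + v²)` there). [folklore] -/
theorem half_le_chebX_sq_add_chebX_sq {x : ℝ} (hx : |x| ≤ 2) (n : ℕ) :
    1 / 2 ≤ chebX (n + 1) x ^ 2 + chebX n x ^ 2 := by
  have h := chebX_sq_invariant x n
  obtain ⟨hx1, hx2⟩ := abs_le.mp hx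
  set u := chebX (n + 1) x
  set v := chebX n x
  nlinarith [mul_nonneg (show (0 : ℝ) ≤ 2 - x by linarith) (sq_nonneg (u - v)),
    mul_nonneg (show (0 : ℝ) ≤ x + 2 by linarith) (sq_nonneg (u + v))]

/-- **Christoffel-function lower bound on `[-2, 2]`**: `Σ_{n=0}^{M} X_n(x)² ≥ (M+1)/4` for
`|x| ≤ 2` (so the reproducing-kernel test polynomial of degree `M` at a point of `[-2,2]` has mass
`≍ 1/M`, the source of the main term `r/(M+1)` in Murty–Sinha Thm. 22). [folklore] -/
theorem sum_chebX_sq_ge {x : ℝ} (hx : |x| ≤ 2) (M : ℕ) :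
    ((M : ℝ) + 1) / 4 ≤ ∑ n ∈ range (M + 1), chebX n x ^ 2 := by
  have key : ∀ M : ℕ, ((M : ℝ) + 1) / 4 ≤ ∑ n ∈ range (M + 1), chebX n x ^ 2 ∧
      ((M : ℝ) + 1 + 1) / 4 ≤ ∑ n ∈ range (M + 1 + 1), chebX n x ^ 2 := by
    intro M
    induction M with
    | zero =>
      refine ⟨by norm_num, ?_⟩
      rw [Finset.sum_range_succ, Finset.sum_range_succ, Finset.sum_range_zero]
      simp only [chebX_zero, chebX_one]
      nlinarith [sq_nonneg x]
    | succ M ih =>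
      obtain ⟨h1, h2⟩ := ih
      refine ⟨by exact_mod_cast h2, ?_⟩
      rw [Finset.sum_range_succ, Finset.sum_range_succ]
      have h3 := half_le_chebX_sq_add_chebX_sq hx (M + 1)
      push_cast at h1 ⊢
      linarith
  exact (key M).1

/-! ### Geometric row sums -/

/-- `Σ_{i<n} t^i ≤ 1/(1-t)` for `0 ≤ t < 1`. [folklore] -/
theorem geom_sum_range_le {t : ℝ} (ht0 : 0 ≤ t) (ht1 : t < 1) (n : ℕ) :
    ∑ i ∈ range n, t ^ i ≤ 1 / (1 - t) := by
  rw [le_div_iff₀ (sub_pos.mpr ht1), geom_sum_mul_neg]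
  linarith [pow_nonneg ht0 n]

/-- The inner geometric sum of the linearisation: `Σ_{j=0}^{min(a,b)} q^{a+b-2j} ≤ q^{|a-b|}/(1-q²)`
(`|a - b| = a + b - 2 min(a,b)`). [folklore] -/
theorem sum_pow_linearisation_le {q : ℝ} (hq0 : 0 ≤ q) (hq1 : q < 1) (a b : ℕ) :
    ∑ j ∈ range (min a b + 1), q ^ (a + b - 2 * j) ≤ q ^ (a + b - 2 * min a b) / (1 - q ^ 2) := by
  set m := min a b with hm
  have hma : m ≤ a := min_le_left a b
  have hmb : m ≤ b := min_le_right a b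
  have hq2 : q ^ 2 < 1 := by nlinarith
  have hreflect : ∑ j ∈ range (m + 1), q ^ (a + b - 2 * j) =
      ∑ i ∈ range (m + 1), q ^ (a + b - 2 * m) * (q ^ 2) ^ i := by
    rw [← Finset.sum_range_reflect (fun i ↦ q ^ (a + b - 2 * m) * (q ^ 2) ^ i) (m + 1)]
    refine Finset.sum_congr rfl fun j hj ↦ ?_
    have hj' : j ≤ m := Nat.lt_succ_iff.mp (Finset.mem_range.mp hj)
    rw [← pow_mul, ← pow_add]
    congr 1
    omega
  rw [hreflect, ← Finset.mul_sum, div_eq_mul_one_div]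
  exact mul_le_mul_of_nonneg_left (geom_sum_range_le (sq_nonneg q) hq2 (m + 1)) (pow_nonneg hq0 _)

/-- **Row-sum (Schur test) bound** `Σ_{b ≤ M} q^{|a-b|} ≤ 2/(1-q)` for `a ≤ M`, `0 ≤ q < 1`.
[folklore] -/
theorem sum_pow_dist_le {q : ℝ} (hq0 : 0 ≤ q) (hq1 : q < 1) {M a : ℕ} (ha : a ≤ M) :
    ∑ b ∈ range (M + 1), q ^ (a + b - 2 * min a b) ≤ 2 / (1 - q) := by
  have hq1' : q ≤ 1 := hq1.le
  rw [← Finset.sum_range_add_sum_Ico _ (show a + 1 ≤ M + 1 by omega)]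
  have hleft : ∑ b ∈ range (a + 1), q ^ (a + b - 2 * min a b) ≤ 1 / (1 - q) := by
    calc ∑ b ∈ range (a + 1), q ^ (a + b - 2 * min a b)
        = ∑ b ∈ range (a + 1), q ^ (a + 1 - 1 - b) := by
          refine Finset.sum_congr rfl fun b hb ↦ ?_
          have hb' : b ≤ a := Nat.lt_succ_iff.mp (Finset.mem_range.mp hb)
          rw [min_eq_right hb']
          congr 1
          omega
      _ = ∑ i ∈ range (a + 1), q ^ i := Finset.sum_range_reflect (fun i ↦ q ^ i) (a + 1)
      _ ≤ 1 / (1 - q) := geom_sum_range_le hq0 hq1 _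
  have hright : ∑ b ∈ Ico (a + 1) (M + 1), q ^ (a + b - 2 * min a b) ≤ 1 / (1 - q) := by
    calc ∑ b ∈ Ico (a + 1) (M + 1), q ^ (a + b - 2 * min a b)
        = ∑ k ∈ range (M + 1 - (a + 1)), q ^ (k + 1) := by
          rw [Finset.sum_Ico_eq_sum_range]
          refine Finset.sum_congr rfl fun k _ ↦ ?_
          rw [min_eq_left (show a ≤ a + 1 + k by omega)]
          congr 1
          omega
      _ ≤ ∑ k ∈ range (M + 1 - (a + 1)), q ^ k := by
          refine Finset.sum_le_sum fun k _ ↦ ?_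
          rw [pow_succ]
          exact mul_le_of_le_one_right (pow_nonneg hq0 k) hq1'
      _ ≤ 1 / (1 - q) := geom_sum_range_le hq0 hq1 _
  calc _ ≤ 1 / (1 - q) + 1 / (1 - q) := add_le_add hleft hright
    _ = 2 / (1 - q) := by ring

/-! ### Theorem 22 of Murty–Sinha from Chebyshev moments -/

/-- **Murty–Sinha, Thm. 22 (mechanism), algebraic form.** Let `x_i` (`i ∈ ι`, `r = |ι|`) be real
numbers, `|α| ≤ 2`, `M ∈ ℕ`, `0 ≤ q < 1`, and suppose the Chebyshev moments satisfy
`|Σ_i X_c(x_i) - r γ_c| ≤ E` for all `c ≤ 2M`, where `|γ_c| ≤ q^c`. Then the multiplicity of `α`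
among the `x_i` is at most `8 r/((1-q)(1-q²)(M+1)) + 4 (M+1) E`.

Murty–Sinha, J. Number Theory 129 (2009), Thm. 22 p. 702: "For a fixed `α`, the number of `i ≤ r`
for which `θ_i = α` is bounded by `r/(M+1) + 4p^M 2^{ν(N)} sup_{f² < 4p^M} ψ(f) + 2f(N) + δ_M(k)`,
for any positive integer value of `M`", where (Thm. 18, p. 698) the last three terms bound the
moment errors `|Σ_i 2cos mθ_i - c_m r|`, `m ≤ M`, and `c_0 = 1`, `c_m = p^{-m/2} - p^{-(m-2)/2}`
(`m` even), `0` (`m` odd), i.e. `γ_c = ∫ X_c dμ_p = p^{-c/2}·[c even]`, `q = p^{-1/2}`. The printed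
proof uses Beurling–Selberg minorants/majorants (Thm. 8); this rendering uses the positive test
polynomial `P = Σ_{a ≤ M} X_a(α) X_a` (`P(α) = K := Σ X_a(α)² ≥ (M+1)/4`, `#{x_i = α} K² ≤ Σ_i P(x_i)²`),
the linearisation formula `chebX_mul_chebX`, AM–GM with the row-sum bound `sum_pow_dist_le` for the
main term and Cauchy–Schwarz for the error term; the constant `1` in front of `r/(M+1)` becomes
`8/((1-q)(1-q²))`. [cite: MurtySinha2009, Thm. 22 p. 702 (with Thm. 18 p. 698 and Cor. 23)] -/
theorem card_filter_eq_le_of_chebMoments {ι : Type*} [Fintype ι] (x : ι → ℝ) {α : ℝ}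
    (hα : |α| ≤ 2) (M : ℕ) {q : ℝ} (hq0 : 0 ≤ q) (hq1 : q < 1) (γ : ℕ → ℝ)
    (hγ : ∀ c, |γ c| ≤ q ^ c) {E : ℝ}
    (hE : ∀ c ≤ 2 * M, |∑ i, chebX c (x i) - Fintype.card ι * γ c| ≤ E) :
    ((Finset.univ.filter fun i ↦ x i = α).card : ℝ) ≤
      8 / ((1 - q) * (1 - q ^ 2)) * Fintype.card ι / (M + 1) + 4 * (M + 1) * E := by
  classical
  -- notation
  set r : ℝ := (Fintype.card ι : ℝ) with hr
  set S : ℕ → ℝ := fun c ↦ ∑ i, chebX c (x i) with hS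
  set w : ℕ → ℝ := fun a ↦ chebX a α with hw
  set K : ℝ := ∑ a ∈ range (M + 1), w a ^ 2 with hK_def
  set m : ℝ := ((Finset.univ.filter fun i ↦ x i = α).card : ℝ) with hm_def
  have hr0 : 0 ≤ r := by positivity
  have hm0 : 0 ≤ m := by positivity
  have hM0 : (0 : ℝ) < M + 1 := by positivity
  have hK : ((M : ℝ) + 1) / 4 ≤ K := sum_chebX_sq_ge hα M
  have hKpos : 0 < K := lt_of_lt_of_le (by positivity) hK
  have hq1' : 0 < 1 - q := sub_pos.mpr hq1
  have hq2' : 0 < 1 - q ^ 2 := by nlinarith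
  have hE0 : 0 ≤ E := le_trans (abs_nonneg _) (hE 0 (Nat.zero_le _))
  -- the test polynomial `P = Σ_{a ≤ M} w_a X_a`, `P(α) = K`
  set P : ℝ → ℝ := fun y ↦ ∑ a ∈ range (M + 1), w a * chebX a y with hP
  have hPα : P α = K := by
    simp only [hP, hK_def, hw, sq]
  -- Step 1: `m K² ≤ Σ_i P(x_i)²`
  have h1 : m * K ^ 2 ≤ ∑ i, P (x i) ^ 2 := by
    have hsub : ∑ i ∈ Finset.univ.filter (fun i ↦ x i = α), P (x i) ^ 2 = m * K ^ 2 := by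
      rw [Finset.sum_congr rfl (g := fun _ ↦ K ^ 2) (fun i hi ↦ by
        rw [(Finset.mem_filter.mp hi).2, hPα])]
      simp [hm_def]
    rw [← hsub]
    exact Finset.sum_le_sum_of_subset_of_nonneg (Finset.filter_subset _ _)
      (fun i _ _ ↦ sq_nonneg _)
  -- Step 2: expand `Σ_i P(x_i)² = Σ_a Σ_b w_a w_b Σ_i X_a(x_i) X_b(x_i)`
  have h2 : ∑ i, P (x i) ^ 2 =
      ∑ a ∈ range (M + 1), ∑ b ∈ range (M + 1),
        w a * w b * ∑ i, chebX a (x i) * chebX b (x i) := by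
    calc ∑ i, P (x i) ^ 2
        = ∑ i, ∑ a ∈ range (M + 1), ∑ b ∈ range (M + 1),
            (w a * chebX a (x i)) * (w b * chebX b (x i)) := by
          refine Finset.sum_congr rfl fun i _ ↦ ?_
          rw [sq, hP, Finset.sum_mul_sum]
      _ = ∑ a ∈ range (M + 1), ∑ b ∈ range (M + 1), ∑ i,
            (w a * chebX a (x i)) * (w b * chebX b (x i)) := by
          rw [Finset.sum_comm]
          refine Finset.sum_congr rfl fun a _ ↦ ?_
          rw [Finset.sum_comm]
      _ = _ := by
          refine Finset.sum_congr rfl fun a _ ↦ Finset.sum_congr rfl fun b _ ↦ ?_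
          rw [Finset.mul_sum]
          refine Finset.sum_congr rfl fun i _ ↦ ?_
          ring
  -- Step 3: each moment is controlled: `|S_c| ≤ r q^c + E` for `c ≤ 2M`
  have hSc : ∀ c ≤ 2 * M, |S c| ≤ r * q ^ c + E := by
    intro c hc
    have h := hE c hc
    have hγc : |r * γ c| ≤ r * q ^ c := by
      rw [abs_mul, abs_of_nonneg hr0]
      exact mul_le_mul_of_nonneg_left (hγ c) hr0
    calc |S c| = |(S c - r * γ c) + r * γ c| := by rw [sub_add_cancel]
      _ ≤ |S c - r * γ c| + |r * γ c| := abs_add_le _ _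
      _ ≤ E + r * q ^ c := add_le_add h hγc
      _ = r * q ^ c + E := add_comm _ _
  -- Step 4: the pair sums `T(a,b) = Σ_i X_a(x_i) X_b(x_i)` via linearisation
  have h4 : ∀ a ∈ range (M + 1), ∀ b ∈ range (M + 1),
      |∑ i, chebX a (x i) * chebX b (x i)| ≤
        r * (q ^ (a + b - 2 * min a b) / (1 - q ^ 2)) + (M + 1) * E := by
    intro a ha b hb
    have ha' : a ≤ M := Nat.lt_succ_iff.mp (Finset.mem_range.mp ha)
    have hb' : b ≤ M := Nat.lt_succ_iff.mp (Finset.mem_range.mp hb)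
    have hlin : ∑ i, chebX a (x i) * chebX b (x i) =
        ∑ j ∈ range (min a b + 1), S (a + b - 2 * j) := by
      simp_rw [chebX_mul_chebX, hS]
      rw [Finset.sum_comm]
    rw [hlin]
    have hmin : ((min a b + 1 : ℕ) : ℝ) ≤ M + 1 := by
      have : min a b ≤ M := le_trans (min_le_left a b) ha'
      exact_mod_cast Nat.succ_le_succ this
    calc |∑ j ∈ range (min a b + 1), S (a + b - 2 * j)|
        ≤ ∑ j ∈ range (min a b + 1), |S (a + b - 2 * j)| := Finset.abs_sum_le_sum_abs _ _
      _ ≤ ∑ j ∈ range (min a b + 1), (r * q ^ (a + b - 2 * j) + E) :=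
          Finset.sum_le_sum fun j _ ↦ hSc _ (by omega)
      _ = r * ∑ j ∈ range (min a b + 1), q ^ (a + b - 2 * j) + ((min a b + 1 : ℕ) : ℝ) * E := by
          rw [Finset.sum_add_distrib, Finset.mul_sum, Finset.sum_const, Finset.card_range,
            nsmul_eq_mul]
      _ ≤ r * (q ^ (a + b - 2 * min a b) / (1 - q ^ 2)) + (M + 1) * E := by
          gcongr
          exact sum_pow_linearisation_le hq0 hq1 a b
  -- Step 5: main-term bookkeeping `Σ_a Σ_b |w_a| |w_b| q^{|a-b|} ≤ 2K/(1-q)`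
  have h5 : ∑ a ∈ range (M + 1), ∑ b ∈ range (M + 1),
      |w a| * |w b| * q ^ (a + b - 2 * min a b) ≤ 2 / (1 - q) * K := by
    have hsymm : ∀ a b : ℕ, a + b - 2 * min a b = b + a - 2 * min b a := fun a b ↦ by
      rw [min_comm, add_comm]
    calc ∑ a ∈ range (M + 1), ∑ b ∈ range (M + 1), |w a| * |w b| * q ^ (a + b - 2 * min a b)
        ≤ ∑ a ∈ range (M + 1), ∑ b ∈ range (M + 1),
            ((w a ^ 2 / 2) * q ^ (a + b - 2 * min a b) +
              (w b ^ 2 / 2) * q ^ (a + b - 2 * min a b)) := by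
          refine Finset.sum_le_sum fun a _ ↦ Finset.sum_le_sum fun b _ ↦ ?_
          have hq : 0 ≤ q ^ (a + b - 2 * min a b) := pow_nonneg hq0 _
          have hamgm : |w a| * |w b| ≤ w a ^ 2 / 2 + w b ^ 2 / 2 := by
            nlinarith [sq_nonneg (|w a| - |w b|), sq_abs (w a), sq_abs (w b)]
          nlinarith
      _ = ∑ a ∈ range (M + 1), ∑ b ∈ range (M + 1), (w a ^ 2 / 2) * q ^ (a + b - 2 * min a b) +
            ∑ a ∈ range (M + 1), ∑ b ∈ range (M + 1),
              (w b ^ 2 / 2) * q ^ (a + b - 2 * min a b) := by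
          rw [← Finset.sum_add_distrib]
          refine Finset.sum_congr rfl fun a _ ↦ ?_
          rw [← Finset.sum_add_distrib]
      _ = ∑ a ∈ range (M + 1), ∑ b ∈ range (M + 1), (w a ^ 2 / 2) * q ^ (a + b - 2 * min a b) +
            ∑ b ∈ range (M + 1), ∑ a ∈ range (M + 1),
              (w b ^ 2 / 2) * q ^ (b + a - 2 * min b a) := by
          congr 1
          rw [Finset.sum_comm]
          refine Finset.sum_congr rfl fun b _ ↦ Finset.sum_congr rfl fun a _ ↦ ?_
          rw [hsymm a b]
      _ = ∑ a ∈ range (M + 1), w a ^ 2 * ∑ b ∈ range (M + 1), q ^ (a + b - 2 * min a b) := by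
          rw [← Finset.sum_add_distrib]
          refine Finset.sum_congr rfl fun a _ ↦ ?_
          rw [Finset.mul_sum, ← Finset.sum_add_distrib]
          refine Finset.sum_congr rfl fun b _ ↦ ?_
          ring
      _ ≤ ∑ a ∈ range (M + 1), w a ^ 2 * (2 / (1 - q)) := by
          refine Finset.sum_le_sum fun a ha ↦ ?_
          have ha' : a ≤ M := Nat.lt_succ_iff.mp (Finset.mem_range.mp ha)
          exact mul_le_mul_of_nonneg_left (sum_pow_dist_le hq0 hq1 ha') (sq_nonneg _)
      _ = 2 / (1 - q) * K := by
          rw [← Finset.sum_mul, mul_comm]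
  -- Step 6: error-term bookkeeping `(Σ_a |w_a|)² ≤ (M+1) K` (Cauchy–Schwarz)
  have h6 : (∑ a ∈ range (M + 1), |w a|) ^ 2 ≤ (M + 1) * K := by
    have := sq_sum_le_card_mul_sum_sq (s := range (M + 1)) (f := fun a ↦ |w a|)
    simp only [Finset.card_range, sq_abs, Nat.cast_add, Nat.cast_one] at this
    simpa [hK_def] using this
  -- Step 7: assemble `Σ_i P(x_i)² ≤ 2 r K/((1-q)(1-q²)) + (M+1)² E K`
  have h7 : ∑ i, P (x i) ^ 2 ≤
      r / (1 - q ^ 2) * (2 / (1 - q) * K) + (M + 1) * E * ((M + 1) * K) := by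
    rw [h2]
    calc ∑ a ∈ range (M + 1), ∑ b ∈ range (M + 1),
          w a * w b * ∑ i, chebX a (x i) * chebX b (x i)
        ≤ ∑ a ∈ range (M + 1), ∑ b ∈ range (M + 1),
            |w a| * |w b| * (r * (q ^ (a + b - 2 * min a b) / (1 - q ^ 2)) + (M + 1) * E) := by
          refine Finset.sum_le_sum fun a ha ↦ Finset.sum_le_sum fun b hb ↦ ?_
          calc w a * w b * ∑ i, chebX a (x i) * chebX b (x i)
              ≤ |w a * w b * ∑ i, chebX a (x i) * chebX b (x i)| := le_abs_self _
            _ = |w a| * |w b| * |∑ i, chebX a (x i) * chebX b (x i)| := by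
                rw [abs_mul, abs_mul]
            _ ≤ |w a| * |w b| * (r * (q ^ (a + b - 2 * min a b) / (1 - q ^ 2)) + (M + 1) * E) :=
                mul_le_mul_of_nonneg_left (h4 a ha b hb) (by positivity)
      _ = r / (1 - q ^ 2) * ∑ a ∈ range (M + 1), ∑ b ∈ range (M + 1),
              |w a| * |w b| * q ^ (a + b - 2 * min a b) +
            (M + 1) * E * ((∑ a ∈ range (M + 1), |w a|) * ∑ b ∈ range (M + 1), |w b|) := by
          rw [Finset.sum_mul_sum, Finset.mul_sum, Finset.mul_sum, ← Finset.sum_add_distrib]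
          refine Finset.sum_congr rfl fun a _ ↦ ?_
          rw [Finset.mul_sum, Finset.mul_sum, ← Finset.sum_add_distrib]
          refine Finset.sum_congr rfl fun b _ ↦ ?_
          ring
      _ ≤ r / (1 - q ^ 2) * (2 / (1 - q) * K) + (M + 1) * E * ((M + 1) * K) := by
          refine add_le_add (mul_le_mul_of_nonneg_left h5 (by positivity))
            (mul_le_mul_of_nonneg_left ?_ (by positivity))
          rw [← sq]
          exact h6
  -- Step 8: divide by `K` and use `K ≥ (M+1)/4`
  have hq1ne : (1 - q) ≠ 0 := hq1'.ne'
  have hq2ne : (1 - q ^ 2) ≠ 0 := hq2'.ne'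
  have hMne : ((M : ℝ) + 1) ≠ 0 := hM0.ne'
  have h8 : m * K ≤ 2 * r / ((1 - q) * (1 - q ^ 2)) + (M + 1) ^ 2 * E := by
    have e1 : r / (1 - q ^ 2) * (2 / (1 - q) * K) + (M + 1) * E * ((M + 1) * K) =
        (2 * r / ((1 - q) * (1 - q ^ 2)) + (M + 1) ^ 2 * E) * K := by
      field_simp
    have hmain : m * K * K ≤ (2 * r / ((1 - q) * (1 - q ^ 2)) + (M + 1) ^ 2 * E) * K := by
      rw [← e1, mul_assoc, ← sq]
      exact h1.trans h7
    exact le_of_mul_le_mul_right hmain hKpos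
  have h9 : m * ((M + 1) / 4) ≤ 2 * r / ((1 - q) * (1 - q ^ 2)) + (M + 1) ^ 2 * E :=
    (mul_le_mul_of_nonneg_left hK hm0).trans h8
  -- conclude
  have hfinal : m ≤ (2 * r / ((1 - q) * (1 - q ^ 2)) + (M + 1) ^ 2 * E) * 4 / (M + 1) := by
    rw [le_div_iff₀ hM0]
    linarith
  calc m ≤ (2 * r / ((1 - q) * (1 - q ^ 2)) + (M + 1) ^ 2 * E) * 4 / (M + 1) := hfinal
    _ = 8 / ((1 - q) * (1 - q ^ 2)) * r / (M + 1) + 4 * (M + 1) * E := by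
        field_simp
        ring

end MurtySinha

end Literature.NumberTheory.EllipticCurves.ModularForms
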